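import Literature.MathematicalPhysics.StatisticalMechanics.BarlowStacking
import Literature.MathematicalPhysics.StatisticalMechanics.HaggStacking
import Literature.MathematicalPhysics.StatisticalMechanics.LocalMatchingCompactness
import Literature.Geometry.DiscreteGeometry.SeparatedSets

/-!
# `BarlowLiouville` (route `DisclinationRation`), stub `stub_pigeonhole`: some point of a big
# ball is good

Support file for item stmt-AtomisticToContinuum-15801 (crux
`Summit.AtomisticToContinuum.Crystallization.Theses.DisclinationRation.BarlowLiouville`, line
`Sketch`). Pure counting, no energy:

* `pg_finite_ball` — a `δ`-separated set `X ⊆ ℝ³` meets every closed ball `dist · 0 ≤ L` in a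
  finite set (`finite_of_forall_le_dist_of_subset_closedBall`; import-compatible with the route file's cone);
* `pg_many_points` — a relatively dense (`R₁`-net), `δ`-separated `X` has at least `(2K+1)³`
  points in the ball of radius `(2R₁+2) √3 K + R₁` about `0` (the nearest points of `X` to the
  `(2K+1)³` points of a cubic grid of spacing `2R₁ + 2`, pairwise distinct,
  `CubePacking.exists_separated_lattice`);
* `pg_exists_good` — if moreover the points of `X` failing a property `P` number `≤ θ L³` in
  `B̄_L(ctr)` for `L ≥ L₀(θ)`, every `θ > 0`, then some point of `X` satisfies `P`
  (`θ L³ ≤ K³ < (2K+1)³` for `L` as above and `θ` small);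
* `stub_pigeonhole` — the registered stub: instantiate `P y` with "`X - y` is two-way `η`-matched
  on `‖·‖ ≤ R` with a rigid image of a relaxed layered set" and translate the good point to the
  origin (`t := -y`).

No new definitions.
-/

namespace Summit.AtomisticToContinuum.Crystallization.Theorems.DisclinationRationBarlowLiouville

open Literature.MathematicalPhysics.StatisticalMechanics Literature.Geometry.DiscreteGeometry

/-- Euclidean `3`-space. -/
local notation "E3" => EuclideanSpace ℝ (Fin 3)

/-! ## Counting points of a separated net in a ball -/

/-- A `δ`-separated subset of `ℝ³` meets every closed ball about the origin in a finite set
(packing by volume). [folklore] -/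
theorem pg_finite_ball {X : Set E3} {δ : ℝ} (hδ : 0 < δ)
    (hsep : ∀ y ∈ X, ∀ z ∈ X, y ≠ z → δ ≤ dist y z) (L : ℝ) :
    ({y : E3 | y ∈ X ∧ dist y 0 ≤ L} : Set E3).Finite := by
  exact finite_of_forall_le_dist_of_subset_closedBall hδ
    (fun p hp q hq hpq => hsep p hp.1 q hq.1 hpq) (c := 0) (R := L)
    (fun y hy => Metric.mem_closedBall.2 hy.2)

/-- **Many points in a big ball.** If every point of `ℝ³` is within `R₁` of the `δ`-separated set
`X`, then for every `K : ℕ` the ball `dist · 0 ≤ (2R₁ + 2) √3 K + R₁` contains at least `(2K+1)³`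
points of `X`: the nearest points of `X` to the `(2K+1)³` points of a cubic grid of spacing
`2R₁ + 2` centred at `0` are pairwise distinct. [folklore] -/
theorem pg_many_points {X : Set E3} {δ R₁ : ℝ} (hδ : 0 < δ)
    (hsep : ∀ y ∈ X, ∀ z ∈ X, y ≠ z → δ ≤ dist y z)
    (hdense : ∀ p : E3, ∃ y ∈ X, dist y p ≤ R₁) (K : ℕ) :
    (2 * K + 1) ^ 3 ≤
      ({y : E3 | y ∈ X ∧ dist y 0 ≤ (2 * R₁ + 2) * Real.sqrt 3 * K + R₁} : Set E3).ncard := by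
  classical
  have hR₁ : 0 ≤ R₁ := by
    obtain ⟨y, -, hy⟩ := hdense 0
    exact dist_nonneg.trans hy
  have hs : (0 : ℝ) < 2 * R₁ + 2 := by linarith
  -- the grid
  obtain ⟨Λ, hΛcard, hΛnorm, hΛsep⟩ := CubePacking.exists_separated_lattice (0 : E3) hs K
  -- nearest points of `X`
  choose f hfX hfd using hdense
  -- `f` is injective on the grid: two grid points with the same nearest point are `≤ 2R₁` apart
  have hinj : Set.InjOn f Λ := by
    intro g hg g' hg' hfg
    by_contra hne
    have h1 : 2 * R₁ + 2 ≤ ‖g - g'‖ := hΛsep g hg g' hg' hne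
    have h2 : dist g g' ≤ dist (f g) g + dist (f g') g' :=
      calc dist g g' ≤ dist g (f g) + dist (f g) g' := dist_triangle _ _ _
        _ = dist (f g) g + dist (f g') g' := by rw [dist_comm g (f g), hfg]
    have h3 := hfd g
    have h4 := hfd g'
    rw [← dist_eq_norm] at h1
    linarith
  -- the image of the grid lies in the ball
  have hsub : (↑(Λ.image f) : Set E3) ⊆
      {y : E3 | y ∈ X ∧ dist y 0 ≤ (2 * R₁ + 2) * Real.sqrt 3 * K + R₁} := by
    intro y hy
    rw [Finset.coe_image] at hy
    obtain ⟨g, hg, rfl⟩ := hy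
    refine ⟨hfX g, ?_⟩
    have h1 : dist g 0 ≤ (2 * R₁ + 2) * Real.sqrt 3 * K := by
      have := hΛnorm g hg
      simpa [dist_eq_norm] using this
    calc dist (f g) 0 ≤ dist (f g) g + dist g 0 := dist_triangle _ _ _
      _ ≤ R₁ + (2 * R₁ + 2) * Real.sqrt 3 * K := add_le_add (hfd g) h1
      _ = (2 * R₁ + 2) * Real.sqrt 3 * K + R₁ := by ring
  have := Set.ncard_le_ncard hsub (pg_finite_ball hδ hsep _)
  rwa [Set.ncard_coe_finset, Finset.card_image_of_injOn hinj, hΛcard] at this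

/-- **Pigeonhole.** Let `X ⊆ ℝ³` be `δ`-separated and relatively dense, and let `P` be a property
of points such that, for every `θ > 0`, the points of `X ∩ B̄_L(ctr)` failing `P` number at most
`θ L³` for all `L ≥ L₀(θ)` and all centres. Then some point of `X` satisfies `P`: with
`c = (2R₁+2)√3 + R₁` and `θ = 1/c³`, the ball of radius `L = (2R₁+2)√3 K + R₁ ≤ cK` about `0`
holds `≥ (2K+1)³ > K³ ≥ θ L³` points of `X`. [folklore] -/
theorem pg_exists_good {X : Set E3} {δ R₁ : ℝ} (hδ : 0 < δ)
    (hsep : ∀ y ∈ X, ∀ z ∈ X, y ≠ z → δ ≤ dist y z)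
    (hdense : ∀ p : E3, ∃ y ∈ X, dist y p ≤ R₁) (P : E3 → Prop)
    (hbad : ∀ θ : ℝ, 0 < θ → ∃ L₀ : ℝ, ∀ L : ℝ, L₀ ≤ L → ∀ ctr : E3,
      (({y : E3 | y ∈ X ∧ dist y ctr ≤ L ∧ ¬ P y} : Set E3).ncard : ℝ) ≤ θ * L ^ 3) :
    ∃ y ∈ X, P y := by
  have hR₁ : 0 ≤ R₁ := by
    obtain ⟨y, -, hy⟩ := hdense 0
    exact dist_nonneg.trans hy
  have h3 : (1 : ℝ) ≤ Real.sqrt 3 := Real.one_le_sqrt.2 (by norm_num)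
  -- the slope `c` of the radius `L = (2R₁+2)√3 K + R₁ ≤ c K`
  have hc : (0 : ℝ) < (2 * R₁ + 2) * Real.sqrt 3 + R₁ := by
    have : (2 * R₁ + 2) ≤ (2 * R₁ + 2) * Real.sqrt 3 :=
      le_mul_of_one_le_right (by linarith) h3
    linarith
  obtain ⟨L₀, hL₀⟩ := hbad (1 / ((2 * R₁ + 2) * Real.sqrt 3 + R₁) ^ 3) (by positivity)
  -- the size of the grid
  obtain ⟨K, hK⟩ : ∃ K : ℕ, max L₀ 1 ≤ K := exists_nat_ge (max L₀ 1)
  have hK1 : (1 : ℝ) ≤ K := (le_max_right _ _).trans hK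
  have hKL₀ : L₀ ≤ K := (le_max_left _ _).trans hK
  -- the radius `L`
  have hsK : (K : ℝ) ≤ (2 * R₁ + 2) * Real.sqrt 3 * K := by
    have h1 : (1 : ℝ) ≤ (2 * R₁ + 2) * Real.sqrt 3 := by nlinarith
    simpa using mul_le_mul_of_nonneg_right h1 (Nat.cast_nonneg K)
  have hKL : (K : ℝ) ≤ (2 * R₁ + 2) * Real.sqrt 3 * K + R₁ := by linarith
  have hLc : (2 * R₁ + 2) * Real.sqrt 3 * K + R₁ ≤ ((2 * R₁ + 2) * Real.sqrt 3 + R₁) * K := by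
    have : R₁ ≤ R₁ * K := le_mul_of_one_le_right hR₁ hK1
    linarith
  -- the bad points of the ball are few ...
  have hfew := hL₀ ((2 * R₁ + 2) * Real.sqrt 3 * K + R₁) (hKL₀.trans hKL) 0
  have hfew' : (({y : E3 | y ∈ X ∧ dist y 0 ≤ (2 * R₁ + 2) * Real.sqrt 3 * K + R₁ ∧ ¬ P y} :
      Set E3).ncard : ℝ) < (((2 * K + 1) ^ 3 : ℕ) : ℝ) := by
    have h0 : (0 : ℝ) ≤ ((2 * R₁ + 2) * Real.sqrt 3 * K + R₁) / ((2 * R₁ + 2) * Real.sqrt 3 + R₁) :=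
      div_nonneg (by linarith) hc.le
    have h1 : ((2 * R₁ + 2) * Real.sqrt 3 * K + R₁) / ((2 * R₁ + 2) * Real.sqrt 3 + R₁) ≤ K := by
      rw [div_le_iff₀ hc]
      linarith
    have h2 : 1 / ((2 * R₁ + 2) * Real.sqrt 3 + R₁) ^ 3 *
        ((2 * R₁ + 2) * Real.sqrt 3 * K + R₁) ^ 3 ≤ (K : ℝ) ^ 3 := by
      calc 1 / ((2 * R₁ + 2) * Real.sqrt 3 + R₁) ^ 3 * ((2 * R₁ + 2) * Real.sqrt 3 * K + R₁) ^ 3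
            = (((2 * R₁ + 2) * Real.sqrt 3 * K + R₁) / ((2 * R₁ + 2) * Real.sqrt 3 + R₁)) ^ 3 := by
            rw [div_pow]; ring
        _ ≤ (K : ℝ) ^ 3 := pow_le_pow_left₀ h0 h1 3
    have h3 : (K : ℝ) ^ 3 < (((2 * K + 1) ^ 3 : ℕ) : ℝ) := by
      push_cast
      exact pow_lt_pow_left₀ (by linarith) (Nat.cast_nonneg K) three_ne_zero
    linarith
  -- ... but all points of the ball are many
  have hmany := pg_many_points hδ hsep hdense K
  by_contra hno
  push Not at hno
  have hsub : {y : E3 | y ∈ X ∧ dist y 0 ≤ (2 * R₁ + 2) * Real.sqrt 3 * K + R₁} ⊆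
      {y : E3 | y ∈ X ∧ dist y 0 ≤ (2 * R₁ + 2) * Real.sqrt 3 * K + R₁ ∧ ¬ P y} :=
    fun y hy => ⟨hy.1, hy.2, hno y hy.1⟩
  have hfin : ({y : E3 | y ∈ X ∧ dist y 0 ≤ (2 * R₁ + 2) * Real.sqrt 3 * K + R₁ ∧ ¬ P y} :
      Set E3).Finite :=
    (pg_finite_ball hδ hsep _).subset fun y hy => ⟨hy.1, hy.2.1⟩
  have hle : (2 * K + 1) ^ 3 ≤
      ({y : E3 | y ∈ X ∧ dist y 0 ≤ (2 * R₁ + 2) * Real.sqrt 3 * K + R₁ ∧ ¬ P y} : Set E3).ncard :=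
    hmany.trans (Set.ncard_le_ncard hsub hfin)
  have hle' : (((2 * K + 1) ^ 3 : ℕ) : ℝ) ≤ (({y : E3 | y ∈ X ∧
      dist y 0 ≤ (2 * R₁ + 2) * Real.sqrt 3 * K + R₁ ∧ ¬ P y} : Set E3).ncard : ℝ) := by
    exact_mod_cast hle
  linarith

/-! ## The registered stub -/

/-- STUB P (M) — pigeonhole: if `X` is `δ`-separated and relatively dense and, for every `(R, η)`, its
`(R, η)`-bad points (those `y` about which `X − y` is not two-way `η`-matched on `‖·‖ ≤ R` with a rigid
image of a relaxed layered set) have density zero uniformly on balls, then `X` has near-layered patches at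
every scale (a relatively dense set has `≥ c·L³` points in `B̄_L(0)` for large `L`, so some point of
`B̄_L(0)` is good; translate it to the origin, `t := −y`). Pure counting, no energy. [folklore] -/
theorem stub_pigeonhole :
    ∀ δ : ℝ, 0 < δ → ∀ X : Set E3, (∀ y ∈ X, ∀ z ∈ X, y ≠ z → δ ≤ dist y z) →
    (∃ R₁ : ℝ, ∀ p : E3, ∃ y ∈ X, dist y p ≤ R₁) →
    (∀ R η : ℝ, 0 < η → ∀ θ : ℝ, 0 < θ → ∃ L₀ : ℝ, ∀ L : ℝ, L₀ ≤ L → ∀ ctr : E3,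
      (({y : E3 | y ∈ X ∧ dist y ctr ≤ L ∧ ¬ (∃ a : ℝ, 47 / 50 ≤ a ∧ a ≤ 1 ∧
            ∃ (A : E3 →ₗᵢ[ℝ] E3) (s : ℤ → ℤ) (z : ℤ → ℝ), IsHaggSeq s ∧
              (∀ m : ℤ, 39 / 50 * a ≤ z (m + 1) - z m ∧ z (m + 1) - z m ≤ 17 / 20 * a) ∧
              let S : Set E3 := {p | ∃ m i j : ℤ, p = A (((i : ℝ) • triangularVec₁ a) +
                ((j : ℝ) • triangularVec₂ a) + ((haggLabel s m : ℝ) • barlowOffset a) +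
                (z m • layerNormal 1))}
              (∀ p ∈ S, ‖p‖ ≤ R → ∃ q ∈ X, dist (q - y) p ≤ η) ∧
              (∀ q ∈ X, ‖q - y‖ ≤ R → ∃ p ∈ S, dist (q - y) p ≤ η))} : Set E3).ncard : ℝ)
        ≤ θ * L ^ 3) →
    ∀ R η : ℝ, 0 < η → ∃ a : ℝ, 47 / 50 ≤ a ∧ a ≤ 1 ∧
      ∃ (A : E3 →ₗᵢ[ℝ] E3) (t : E3) (s : ℤ → ℤ) (z : ℤ → ℝ), IsHaggSeq s ∧
        (∀ m : ℤ, 39 / 50 * a ≤ z (m + 1) - z m ∧ z (m + 1) - z m ≤ 17 / 20 * a) ∧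
        let S : Set E3 := {p | ∃ m i j : ℤ, p = A (((i : ℝ) • triangularVec₁ a) +
          ((j : ℝ) • triangularVec₂ a) + ((haggLabel s m : ℝ) • barlowOffset a) + (z m • layerNormal 1))}
        (∀ p ∈ S, ‖p‖ ≤ R → ∃ q ∈ X, dist (q + t) p ≤ η) ∧
        (∀ q ∈ X, ‖q + t‖ ≤ R → ∃ p ∈ S, dist (q + t) p ≤ η) := by
  intro δ hδ X hsep hdense hbad R η hη
  obtain ⟨R₁, hR₁⟩ := hdense
  obtain ⟨y, -, hy⟩ := pg_exists_good hδ hsep hR₁ (fun y => ∃ a : ℝ, 47 / 50 ≤ a ∧ a ≤ 1 ∧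
      ∃ (A : E3 →ₗᵢ[ℝ] E3) (s : ℤ → ℤ) (z : ℤ → ℝ), IsHaggSeq s ∧
        (∀ m : ℤ, 39 / 50 * a ≤ z (m + 1) - z m ∧ z (m + 1) - z m ≤ 17 / 20 * a) ∧
        let S : Set E3 := {p | ∃ m i j : ℤ, p = A (((i : ℝ) • triangularVec₁ a) +
          ((j : ℝ) • triangularVec₂ a) + ((haggLabel s m : ℝ) • barlowOffset a) +
          (z m • layerNormal 1))}
        (∀ p ∈ S, ‖p‖ ≤ R → ∃ q ∈ X, dist (q - y) p ≤ η) ∧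
        (∀ q ∈ X, ‖q - y‖ ≤ R → ∃ p ∈ S, dist (q - y) p ≤ η)) (hbad R η hη)
  obtain ⟨a, ha, ha1, A, s, z, hs, hz, hmatch⟩ := hy
  refine ⟨a, ha, ha1, A, -y, s, z, hs, hz, ?_⟩
  simpa only [sub_eq_add_neg] using hmatch

end Summit.AtomisticToContinuum.Crystallization.Theorems.DisclinationRationBarlowLiouville
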